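import Literature.Probability.RandomPlanarGeometry.HexSAWStripIdentity
import HarnessLib

/-!
# `B_T(x_c) > 0` for every strip of the honeycomb lattice (support face S0′ of the door «HEX-YC-DCS»)

Topic `Literature/Probability/RandomPlanarGeometry` (continues `HexSAWStripIdentity.lean` — the UNCONDITIONAL
Duminil-Copin–Smirnov lower bound `HV.stripBlim_ge_div`: `B_{T+1} ≥ min(B_1, x_c/c_α)/(T+1)` with the positive
constant `HV.stripBlim_ge_div_pos`, and `HV.stripBlim_one_pos` of `HexSAWLowerBound.lean`).  Source: H. Duminil-Copin,
S. Smirnov, *The connective constant of the honeycomb lattice equals `√(2+√2)`*, Ann. of Math. 175 (2012), §3, proof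
of Theorem 1, printed display (arXiv:1007.0575 p. 7): "`B_T^{x_c} ≥ min[B_1^{x_c}, 1/(c_α x_c)]/T`" for every `T ≥ 1`, hence
`B_T > 0`.  (The tree's `HV.stripBlim_ge_div` is the WEAKER form with the constant `x_c/c_α = 1/(c_α x_c⁻¹) < 1/(c_α x_c)`,
which is all positivity needs; it is not the printed constant.)

* **`HV.stripBlim_pos`** — `0 < B_T(x_c)` for every `T ≥ 1` (face S0′ `StripBlimPos` of a-idea-1 gen 17's door R96′
  «HEX-YC-DCS», Sketch_G17 l. 432, the positivity consumed by `stripByUnbounded_of_faces`).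
-/

noncomputable section

namespace Literature.Probability.RandomPlanarGeometry.SAW.HV

/-- **`B_T(x_c) > 0` for every `T ≥ 1`**: `B_1 > 0` and `B_{T+1} ≥ min(B_1, x_c/c_α)/(T+1) > 0`.
[cite: DuminilCopinSmirnov2012, §3 (proof of Theorem 1, arXiv:1007.0575 p. 7: "B_T^{x_c} ≥ min[B_1^{x_c}, 1/(c_α x_c)]/T"; the tree's weaker constant x_c/c_α is used)] -/
theorem stripBlim_pos {T : ℕ} (hT : 1 ≤ T) : 0 < stripBlim T := by
  obtain ⟨T, rfl⟩ : ∃ T', T = T' + 1 := ⟨T - 1, by omega⟩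
  exact lt_of_lt_of_le (div_pos stripBlim_ge_div_pos (by positivity)) (stripBlim_ge_div T)

/-- Face S0′ `StripBlimPos` of the door «HEX-YC-DCS», verbatim (a-idea-1 gen 17, Sketch_G17 l. 432).
[cite: DuminilCopinSmirnov2012, §3 (proof of Theorem 1)] -/
def StripBlimPos : Prop := ∀ T : ℕ, 1 ≤ T → 0 < stripBlim T

/-- S0′ holds. [cite: DuminilCopinSmirnov2012, §3 (proof of Theorem 1)] -/
theorem stripBlimPos_holds : StripBlimPos := fun _ hT => stripBlim_pos hT

end Literature.Probability.RandomPlanarGeometry.SAW.HV
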